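import Literature.AlgebraicGeometry.Resolution.RegularLocalRingsNormal
import Literature.RingTheory.PBasis.KimuraNiitsuma1980
import HarnessLib

/-!
# Route `RadicialJung`, crux `CleanModels` (stmt-15917): `p`-INDEPENDENCE OF A REGULAR SYSTEM OF
# PARAMETERS TOGETHER WITH RESIDUALLY `p`-INDEPENDENT UNITS — piece (A1) of the T2 `p`-basis discharge

Support file (OURS) for PROGRAMME-clean-dim2 / T2 (`HOME/L/res-L0-w81-pv-2/g5/T2-ARCHITECTURE.md`):
the T2 bricks (`giraud_exactness`, the read-off) take a `p`-basis `Γ ∋ x, y` of `𝒪_{X,ξ}` over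
`𝒪_{X,ξ}^p` as a parameter; this file and its sequels DISCHARGE its existence at closed points of a
regular variety over an arbitrary field of characteristic `p` (Kimura–Niitsuma 1980, Thm. 3.1 /
3.4, re-organised), so that the T2 theorem stays unconditional.

**(A1), this file.** Let `R` be a regular local ring of characteristic `p` with residue field
`κ`, `x_1, …, x_d` a regular system of parameters, and `a_1, …, a_m ∈ R` elements whose residues
are `p`-independent over `κ^p` (the `p^m` monomials `∏ ā_l^{α_l}`, `0 ≤ α_l < p`, are linearly
independent over `κ^p`). Then the `p^{m+d}` monomials `∏ a_l^{α_l} ∏ x_j^{β_j}` (`0 ≤ α_l, β_j < p`)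
are linearly independent over `R^p` (`linearIndependent_monomial_rsop`).

Proof (initial forms; Matsumura Thm. 17.10 = quasi-regularity of `x`, tree
`coeff_mem_maximalIdeal_of_eval_mem_pow`): given `Σ r_ν^p a^{α_ν} x^{β_ν} = 0`, write
`r_ν = G_ν(x)` with `G_ν` a form of degree `n_ν = ord(r_ν)` having a unit coefficient; then
`r_ν^p a^{α_ν} x^{β_ν} = P_ν(x)` for the form `P_ν = Σ_γ a^{α_ν} g_{νγ}^p X^{β_ν + pγ}` of degree
`D_ν = |β_ν| + p n_ν`. With `N = min D_ν`, the form `H = Σ_{D_ν = N} P_ν` has `H(x) ∈ 𝔪^{N+1}`, so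
its coefficients lie in `𝔪`; but the coefficient of `X^{β₀ + pγ₀}` (`ν₀` minimising, `g_{ν₀γ₀}` a
unit) only sees the `ν` with `β_ν = β₀` and `γ = γ₀` (uniqueness of `β + pγ`, `β < p`), and reads
`Σ_α a^α g_{(α,β₀)γ₀}^p ∈ 𝔪` — a `κ^p`-relation among the `ā^α` with the non-zero coefficient
`ḡ_{ν₀γ₀}^p`, contradiction.

References: T. Kimura, H. Niitsuma, J. Math. Soc. Japan 32 (1980), Thm. 3.1, Lemma 2.6;
H. Matsumura, *Commutative Ring Theory*, Thm. 17.10. [cite: KimuraNiitsuma1980, Thm. 3.1]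
-/

noncomputable section

open IsLocalRing MvPolynomial
open Literature.AlgebraicGeometry.Resolution Literature.RingTheory.PBasis

namespace Summit.ResolutionOfSingularities.ResolutionOfSingularities.Theorems.RadicialJung.CleanModels

universe u

section General

/-- Degree of a finitely supported function on a finite type as a plain sum. [folklore] -/
theorem degree_eq_sum_univ {σ : Type*} [Fintype σ] (e : σ →₀ ℕ) : e.degree = ∑ j, e j :=
  Finset.sum_subset (Finset.subset_univ _) fun _ _ hj => Finsupp.notMem_support_iff.mp hj

/-- Uniqueness of `β + p γ` with `β < p` componentwise. [folklore] -/
theorem eq_of_add_smul_eq_add_smul {σ : Type*} {p : ℕ} (hp : 0 < p) {β β₀ γ γ₀ : σ →₀ ℕ}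
    (hβ : ∀ j, β j < p) (hβ₀ : ∀ j, β₀ j < p) (h : β + p • γ = β₀ + p • γ₀) :
    β = β₀ ∧ γ = γ₀ := by
  have hj : ∀ j, β j + p * γ j = β₀ j + p * γ₀ j := fun j => by
    have := DFunLike.congr_fun h j
    simpa [Finsupp.add_apply, Finsupp.smul_apply, smul_eq_mul] using this
  have hβeq : ∀ j, β j = β₀ j := fun j => by
    have h1 := congrArg (· % p) (hj j)
    simp only [Nat.add_mul_mod_self_left, Nat.mod_eq_of_lt (hβ j), Nat.mod_eq_of_lt (hβ₀ j)] at h1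
    exact h1
  refine ⟨Finsupp.ext hβeq, Finsupp.ext fun j => ?_⟩
  have h2 := hj j
  rw [hβeq j] at h2
  have h3 : p * γ j = p * γ₀ j := by omega
  exact Nat.eq_of_mul_eq_mul_left hp h3

/-- The Frobenius of an evaluation: `G(x)^p = Σ_γ g_γ^p x^{pγ}`. [folklore] -/
theorem eval_pow_char_eq_sum {R : Type u} [CommRing R] (p : ℕ) [Fact p.Prime] [CharP R p] {d : ℕ}
    (x : Fin d → R) (G : MvPolynomial (Fin d) R) :
    (eval x G) ^ p = ∑ γ ∈ G.support, G.coeff γ ^ p * ∏ j, x j ^ (p * γ j) := by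
  have h := congrArg (frobenius R p) (eval_eq' x G)
  rw [frobenius_def] at h
  rw [h, map_sum]
  refine Finset.sum_congr rfl fun γ _ => ?_
  rw [map_mul, map_prod, frobenius_def]
  refine congrArg _ (Finset.prod_congr rfl fun j _ => ?_)
  rw [frobenius_def, ← pow_mul, mul_comm]

end General

section Independent

variable {R : Type u} [CommRing R] [IsRegularLocalRing R] {p : ℕ} [Fact p.Prime] [CharP R p]
  [CharP (ResidueField R) p] {d : ℕ} (hd : (maximalIdeal R).spanFinrank = d) (x : Fin d → R)
  (hx : Ideal.span (Set.range x) = maximalIdeal R)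

include hd hx in
/-- **(A1) `p`-independence of a regular system of parameters together with residually
`p`-independent elements.** [cite: KimuraNiitsuma1980, Thm. 3.1] -/
theorem linearIndependent_monomial_rsop {m : ℕ} (a : Fin m → R)
    (ha : LinearIndependent (frobenius (ResidueField R) p).range
      (fun α : Fin m → Fin p => ∏ l, residue R (a l) ^ (α l : ℕ))) :
    LinearIndependent (frobenius R p).range
      (fun ν : (Fin m → Fin p) × (Fin d → Fin p) =>
        (∏ l, a l ^ (ν.1 l : ℕ)) * ∏ j, x j ^ (ν.2 j : ℕ)) := by
  classical
  have hp : p.Prime := Fact.out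
  have hp0 : 0 < p := hp.pos
  rw [Fintype.linearIndependent_iff]
  intro g hg
  simp only [Subring.smul_def, smul_eq_mul] at hg
  by_contra hne
  push Not at hne
  -- `p`-th roots of the coefficients
  have hr : ∀ ν, ∃ r : R, r ^ p = (g ν : R) := fun ν => by
    obtain ⟨r, hr⟩ := (g ν).2
    exact ⟨r, by rw [← hr, frobenius_def]⟩
  choose r hr using hr
  let S' : Finset ((Fin m → Fin p) × (Fin d → Fin p)) := Finset.univ.filter fun ν => (g ν : R) ≠ 0
  have hS'mem : ∀ ν, ν ∈ S' ↔ (g ν : R) ≠ 0 := fun ν => by simp [S']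
  have hS'ne : S'.Nonempty := by
    obtain ⟨ν, hν⟩ := hne
    exact ⟨ν, (hS'mem ν).mpr fun h => hν (Subtype.ext h)⟩
  have hr0 : ∀ ν ∈ S', r ν ≠ 0 := fun ν hν h0 =>
    (hS'mem ν).mp hν (by rw [← hr ν, h0, zero_pow hp.ne_zero])
  -- orders and forms
  have hnG : ∀ ν, ∃ (n : ℕ) (G : MvPolynomial (Fin d) R), ν ∈ S' →
      G.IsHomogeneous n ∧ eval x G = r ν ∧ r ν ∉ maximalIdeal R ^ (n + 1) := by
    intro ν
    by_cases hν : ν ∈ S'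
    · obtain ⟨n, hn, hn'⟩ := exists_mem_pow_and_not_mem_pow_succ (hr0 ν hν)
      rw [← hx] at hn
      obtain ⟨G, hG, hGr⟩ := exists_isHomogeneous_of_mem_span_pow x n hn
      exact ⟨n, G, fun _ => ⟨hG, hGr, hn'⟩⟩
    · exact ⟨0, 0, fun h => (hν h).elim⟩
  choose n G hnG using hnG
  -- degrees
  let D : (Fin m → Fin p) × (Fin d → Fin p) → ℕ := fun ν => (∑ j, (ν.2 j : ℕ)) + p * n ν
  obtain ⟨ν₀, hν₀, hmin⟩ := S'.exists_min_image D hS'ne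
  obtain ⟨hG₀, hG₀r, hr₀⟩ := hnG ν₀ hν₀
  -- a unit coefficient of `G ν₀`
  have hγ₀ : ∃ γ₀, (G ν₀).coeff γ₀ ∉ maximalIdeal R := by
    by_contra h
    push Not at h
    apply hr₀
    have hK : G ν₀ ∈ Ideal.map (C : R →+* MvPolynomial (Fin d) R) (maximalIdeal R) := by
      rw [mem_map_C_iff]; exact h
    have := eval_mem_mul_span_pow x hG₀ hK
    rw [hx, ← pow_succ'] at this
    rwa [← hG₀r]
  obtain ⟨γ₀, hγ₀⟩ := hγ₀
  -- exponents as finitely supported functions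
  let βf : (Fin m → Fin p) × (Fin d → Fin p) → (Fin d →₀ ℕ) := fun ν =>
    Finsupp.equivFunOnFinite.symm fun j => (ν.2 j : ℕ)
  have hβf : ∀ ν j, βf ν j = (ν.2 j : ℕ) := fun ν j => rfl
  have hβf_lt : ∀ ν j, βf ν j < p := fun ν j => (ν.2 j).2
  have hβf_inj : ∀ ν ν', βf ν = βf ν' → ν.2 = ν'.2 := fun ν ν' h => by
    funext j; exact Fin.ext (by rw [← hβf, ← hβf, h])
  -- the forms `P ν`
  let A : (Fin m → Fin p) × (Fin d → Fin p) → R := fun ν => ∏ l, a l ^ (ν.1 l : ℕ)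
  let P : (Fin m → Fin p) × (Fin d → Fin p) → MvPolynomial (Fin d) R := fun ν =>
    ∑ γ ∈ (G ν).support, monomial (βf ν + p • γ) (A ν * (G ν).coeff γ ^ p)
  have hPhom : ∀ ν ∈ S', (P ν).IsHomogeneous (D ν) := by
    intro ν hν
    refine IsHomogeneous.sum _ _ _ fun γ hγ => isHomogeneous_monomial _ ?_
    have hγdeg : γ.degree = n ν := by
      rw [Finsupp.degree_eq_weight_one]
      exact (hnG ν hν).1 (mem_support_iff.mp hγ)
    rw [map_add, degree_eq_sum_univ, degree_eq_sum_univ (p • γ)]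
    simp only [hβf, Finsupp.smul_apply, smul_eq_mul, ← Finset.mul_sum]
    rw [← degree_eq_sum_univ, hγdeg]
  have hPeval : ∀ ν ∈ S', eval x (P ν) = (g ν : R) * (A ν * ∏ j, x j ^ (ν.2 j : ℕ)) := by
    intro ν hν
    have hterm : ∀ γ ∈ (G ν).support, eval x (monomial (βf ν + p • γ) (A ν * (G ν).coeff γ ^ p)) =
        A ν * (∏ j, x j ^ (ν.2 j : ℕ)) * ((G ν).coeff γ ^ p * ∏ j, x j ^ (p * γ j)) := by
      intro γ _
      rw [eval_monomial, Finsupp.prod_fintype _ _ (fun j => pow_zero (x j))]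
      simp only [Finsupp.add_apply, Finsupp.smul_apply, smul_eq_mul, hβf, pow_add,
        Finset.prod_mul_distrib]
      ring
    rw [map_sum, Finset.sum_congr rfl hterm, ← Finset.mul_sum, ← eval_pow_char_eq_sum p x (G ν),
      (hnG ν hν).2.1, hr ν]
    ring
  -- the form `H` of degree `N = D ν₀`
  let S'' := S'.filter fun ν => D ν = D ν₀
  have hS''sub : ∀ ν ∈ S'', ν ∈ S' ∧ D ν = D ν₀ := fun ν hν => by simpa [S''] using hν
  let H : MvPolynomial (Fin d) R := ∑ ν ∈ S'', P ν
  have hHhom : H.IsHomogeneous (D ν₀) :=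
    IsHomogeneous.sum _ _ _ fun ν hν => (hS''sub ν hν).2 ▸ hPhom ν (hS''sub ν hν).1
  -- `H(x) ∈ 𝔪^{N+1}`
  have hv : ∀ ν, ν ∉ S'' → (g ν : R) * (A ν * ∏ j, x j ^ (ν.2 j : ℕ)) ∈ maximalIdeal R ^ (D ν₀ + 1) := by
    intro ν hν
    by_cases hν' : ν ∈ S'
    · have hlt : D ν₀ < D ν := lt_of_le_of_ne (hmin ν hν') fun h => hν (by simp [S'', hν', h])
      rw [← hPeval ν hν', ← hx]
      exact Ideal.pow_le_pow_right hlt (eval_mem_span_pow x (hPhom ν hν'))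
    · have h0 : (g ν : R) = 0 := by simpa [S'] using hν'
      rw [h0, zero_mul]; exact zero_mem _
  have hHeval : eval x H ∈ maximalIdeal R ^ (D ν₀ + 1) := by
    have h1 : eval x H = ∑ ν ∈ S'', (g ν : R) * (A ν * ∏ j, x j ^ (ν.2 j : ℕ)) := by
      rw [map_sum]
      exact Finset.sum_congr rfl fun ν hν => hPeval ν (hS''sub ν hν).1
    have h2 := Finset.sum_add_sum_compl S'' fun ν => (g ν : R) * (A ν * ∏ j, x j ^ (ν.2 j : ℕ))
    rw [hg] at h2
    have h3 : eval x H = -∑ ν ∈ S''ᶜ, (g ν : R) * (A ν * ∏ j, x j ^ (ν.2 j : ℕ)) := by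
      rw [h1]; exact eq_neg_of_add_eq_zero_left h2
    rw [h3]
    exact neg_mem (Ideal.sum_mem _ fun ν hν => hv ν (Finset.mem_compl.mp hν))
  -- the coefficient of `X^{β₀ + p γ₀}`
  have hcoef := coeff_mem_maximalIdeal_of_eval_mem_pow hd x hx hHhom hHeval (βf ν₀ + p • γ₀)
  have hPcoeff : ∀ ν ∈ S'', (P ν).coeff (βf ν₀ + p • γ₀) =
      if ν.2 = ν₀.2 then A ν * (G ν).coeff γ₀ ^ p else 0 := by
    intro ν _
    simp only [P, coeff_sum, coeff_monomial]
    split_ifs with h2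
    · rw [Finset.sum_eq_single γ₀]
      · have hβ : βf ν = βf ν₀ := by
          ext j; rw [hβf, hβf, h2]
        rw [if_pos (by rw [hβ])]
      · intro γ _ hγne
        rw [if_neg]
        intro heq
        exact hγne (eq_of_add_smul_eq_add_smul hp0 (hβf_lt ν) (hβf_lt ν₀) heq).2
      · intro hγ₀
        rw [if_pos (by ext j; rw [Finsupp.add_apply, Finsupp.add_apply, hβf, hβf, h2]),
          notMem_support_iff.mp hγ₀, zero_pow hp.ne_zero, mul_zero]
    · refine Finset.sum_eq_zero fun γ _ => ?_
      rw [if_neg]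
      intro heq
      exact h2 (hβf_inj ν ν₀ (eq_of_add_smul_eq_add_smul hp0 (hβf_lt ν) (hβf_lt ν₀) heq).1)
  have hHcoeff : H.coeff (βf ν₀ + p • γ₀) =
      ∑ ν ∈ S''.filter (fun ν => ν.2 = ν₀.2), A ν * (G ν).coeff γ₀ ^ p := by
    rw [Finset.sum_filter, ← Finset.sum_congr rfl hPcoeff]
    exact coeff_sum _ _ _
  rw [hHcoeff] at hcoef
  -- pass to the residue field: a `κ^p`-relation among the `ā^α`
  let T : Finset (Fin m → Fin p) := Finset.univ.filter fun α => (α, ν₀.2) ∈ S''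
  have hTmap : S''.filter (fun ν => ν.2 = ν₀.2) =
      T.map ⟨fun α => (α, ν₀.2), fun α α' h => (Prod.mk.inj h).1⟩ := by
    ext ν
    simp only [Finset.mem_filter, Finset.mem_map, Function.Embedding.coeFn_mk, T, Finset.mem_univ,
      true_and]
    constructor
    · rintro ⟨hν, h2⟩
      exact ⟨ν.1, by rw [← h2]; exact hν, by rw [← h2]⟩
    · rintro ⟨α, hα, rfl⟩
      exact ⟨hα, rfl⟩
  rw [hTmap, Finset.sum_map] at hcoef
  have hν₀T : ν₀.1 ∈ T := by
    simp only [T, Finset.mem_filter, Finset.mem_univ, true_and, Prod.mk.eta]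
    simp [S'', hν₀]
  -- the coefficients of the residue relation
  let c : (Fin m → Fin p) → ResidueField R := fun α => residue R ((G (α, ν₀.2)).coeff γ₀)
  let g' : (Fin m → Fin p) → (frobenius (ResidueField R) p).range := fun α =>
    if α ∈ T then ⟨c α ^ p, ⟨c α, frobenius_def _ _⟩⟩ else 0
  have hg'val : ∀ α, (g' α : ResidueField R) = if α ∈ T then c α ^ p else 0 := fun α => by
    simp only [g']; split_ifs <;> rfl
  have hsum : ∑ α, g' α • (∏ l, residue R (a l) ^ (α l : ℕ)) = 0 := by
    have hres : residue R (∑ α ∈ T, A (α, ν₀.2) * (G (α, ν₀.2)).coeff γ₀ ^ p) = 0 :=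
      (residue_eq_zero_iff _).mpr hcoef
    rw [map_sum] at hres
    simp only [Subring.smul_def, smul_eq_mul, hg'val, ite_mul, zero_mul]
    rw [← Finset.sum_filter, Finset.filter_univ_mem, ← hres]
    refine Finset.sum_congr rfl fun α _ => ?_
    simp only [A, c, map_mul, map_pow, map_prod]
    ring
  have h0 := Fintype.linearIndependent_iff.mp ha g' hsum ν₀.1
  have h1 : c ν₀.1 ^ p = 0 := by
    have := congrArg Subtype.val h0
    rwa [hg'val, if_pos hν₀T] at this
  have h2 : c ν₀.1 = 0 := pow_eq_zero_iff (hp.ne_zero) |>.mp h1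
  exact hγ₀ ((residue_eq_zero_iff _).mp (by simpa [c, Prod.mk.eta] using h2))

end Independent

end Summit.ResolutionOfSingularities.ResolutionOfSingularities.Theorems.RadicialJung.CleanModels
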